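import Summits.BirchSwinnertonDyer.BirchSwinnertonDyer.Theorems.ErratumRoadFiveEulerHalfJetchevMaxHLAtPConsumer
import Summits.BirchSwinnertonDyer.BirchSwinnertonDyer.Theorems.ErratumRoadFiveJetchevAtPSwapEnd
import Summits.BirchSwinnertonDyer.BirchSwinnertonDyer.Theorems.ClassRecordThreeEulerHalvesAtThreePoitouTateOfCanonical
import Summits.BirchSwinnertonDyer.BirchSwinnertonDyer.Theorems.ClassRecordThreeKolyvaginShaOrderDivisibleEnd
import HarnessLib

/-!
# Route `ErratumRoadFive` (K2, `p ≥ 5`), crux `EulerHalfNotRamNoInertSetAtFive` (item stmt-BirchSwinnertonDyer-19715), line `birth` v6: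
# the residual S1b CLOSED MODULO THREE PRINTED FACTS + the Cassels–Tate level inputs + `X11aLowerHalf` — McCallum Prop. 5.2 STRUCK
# (cell `bsd-stepL`, lead seat `bsd-line-er5-p1` g0; `--supports stmt-BirchSwinnertonDyer-19715 --as helper`)

WHAT. p615583 §3 (`JetchevMaxHLAtP.res_pOnlyMultCarrierAtFive_of_printFacts_of_lowerX11a`) closed the line's residual S1b (p the ONLY multiplicative prime,
split, `p ∣ ord_p Δ_min`; 334 ∕ 404 census pairs) modulo FOUR printed facts, the first being McCallum 1991 Prop. 5.2 (Kolyvagin's redefinition of `m_∞`,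
flag `Kolyvagin1991-LNM1479-primary-unread`). -w2's p616221 `AtP.Koly.jetchevMaxHLAtP_of_swapPrint` (port of tam3-p1 g10's `…JetchevMaxOfSwapLiterature` at
`3 ↦ p`) replaces Prop. 5.2 by cell bsd-jet's KERNEL prime swap (`JET.Swap.levelRaising_of_literature`) and Prop. 4.4 by Gross 1991 Prop. 3.7 (2) image-free.
THIS FILE re-enters the consumer p612480 on it:
* `jetchevMaxHLAtP_of_swapPrintFacts` — the fact-free HL statement at `p ≥ 5` from the v6 bundle's first three conjuncts {Gross 3.7 (2) image-free,
  `SelmerComplement` of THE canonical invariant maps, Gross §6 ∕ GZ III (3.1) E⁰} + Gross–Zagier + modularity (Poitou–Tate by tam3-p1 g10's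
  `Koly.poitouTate_conj_forall_of_selmerComplement_canonical`).
* `res_pOnlyMultCarrierAtFive_of_swapPrintFacts_of_lowerX11a` — S1b (registered text VERBATIM as conclusion) from the `PublishedInputsFive` conjuncts hGZ hKo hGZK
  hmod hnf hHL hMaz, the Cassels–Tate level inputs (item `ShimuraCasselsTateLevelInputs`; McCallum Cor. 5.6 upper by tam3-p1 g9's
  `…_of_casselsTate_of_frobeniusCongruence_of_E0`), the THREE printed facts, and `X11aLowerHalf` (∀). = skeleton v6's in-line derivation, landed by name.

HONEST FRAMING: THEOREMS ONLY, Theses-free, no `sorry`, no definition, no new named fact; CONDITIONAL on the three printed facts (typed, not proved) and on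
`X11aLowerHalf` (OPEN crux 19064); nothing booked; 19715 NOT closed; BSD is proved for no curve; no summit statement is touched. Credit: -w2 (swap end p616221,
port layers p613260 p613446 p614031), tam3-p1 (p = 3 originals, g9∕g10 derivations), bsd-jet (kernel prime swap, Prop. 4.4 by name), corner-p1, x11b3.
References (locators only): [cite: Jetchev2008, Thm. 1.4 (p. 812), Cor. 1.5] [cite: McCallumLMS1991, §4 Prop. 4.4, §5 Prop. 5.2, Cor. 5.6]
[cite: GrossLMS1991, Prop. 3.7 (2), §6 Prop. 6.2 (1)] [cite: MilneADT2006, Ch. I, Thm. 4.10(b)] [cite: GrossZagier1986Heegner, III (3.1)] [cite: Miller2011LMS, Def. 1.1].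
-/

set_option autoImplicit false
set_option linter.dupNamespace false

noncomputable section

open scoped Classical

namespace Summit.BirchSwinnertonDyer.BirchSwinnertonDyer.Theorems.JetchevMaxHLAtP

open WeierstrassCurve NumberField IsDedekindDomain
  Literature.NumberTheory.EllipticCurves
  Literature.NumberTheory.EllipticCurves.ModularForms
  Literature.NumberTheory.EllipticCurves.Rank1Residual
  Literature.NumberTheory.EllipticCurves.Rank1Residual.Typed
  Summit.BirchSwinnertonDyer.Rank1Residual Summit.BirchSwinnertonDyer.Rank1Residual.X11b
  Summit.BirchSwinnertonDyer.Rank1Residual.X11b.Three.Koly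

/-- **Jetchev Thm. 1.4 (max form) at the multiplicative `p ≥ 5`, HL currency, from THREE printed facts + Gross–Zagier + modularity** (-w2's swap end
`AtP.Koly.jetchevMaxHLAtP_of_swapPrint` with Poitou–Tate from the `SelmerComplement` of the canonical invariant maps). CONDITIONAL on the displayed facts.
[cite: Jetchev2008, Thm. 1.4] [cite: GrossLMS1991, Prop. 3.7 (2)] [cite: MilneADT2006, Ch. I, Thm. 4.10(b)] -/
theorem jetchevMaxHLAtP_of_swapPrintFacts
    (hF : Literature.NumberTheory.EllipticCurves.GrossLMS1991.prop37_2_frobeniusCongruence ∧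
      (∀ (K : Type) [Field K] [NumberField K] (n : ℕ) [NeZero n],
        (Literature.NumberTheory.GaloisCohomology.LocalInvariants.canonical K n).SelmerComplement) ∧
      Literature.NumberTheory.EllipticCurves.Gross1991_heegnerPoint_sub_ratTorsion_mem_E0)
    (hGZ : ∀ (N : ℕ) [NeZero N] (W : WeierstrassCurve ℚ) (K : Type) [Field K] [NumberField K], gross_zagier N W K)
    (hmod : hasEntireLFunction_rat) :
    ∀ (W : WeierstrassCurve ℚ) [W.IsElliptic] [W.IsGloballyMinimal] (p : ℕ) [Fact p.Prime]
      [NeZero (W.conductorNorm ℤ)] (K : Type) [Field K] [NumberField K]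
      (Dt : Literature.NumberTheory.EllipticCurves.ModularForms.ModularParametrizationData W (W.conductorNorm ℤ)) (β : ℤ) (ι : K →+* ℂ),
      5 ≤ p → W.analyticRank = 1 → W.HasMultiplicativeReductionAtPrime p → Literature.NumberTheory.EllipticCurves.Rank1Residual.Surj W p →
      Literature.NumberTheory.EllipticCurves.IsImaginaryQuadratic K →
      Literature.NumberTheory.EllipticCurves.SatisfiesHeegnerHypothesis (W.conductorNorm ℤ) K →
      Odd (NumberField.discr K) → NumberField.discr K < -4 →
      (W.quadraticTwist (NumberField.discr K : ℚ)).entireLFunction 1 ≠ 0 →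
      (4 * (W.conductorNorm ℤ : ℤ)) ∣ β ^ 2 - NumberField.discr K → ¬ (p : ℤ) ∣ Dt.c →
      ∀ (v : IsDedekindDomain.HeightOneSpectrum (NumberField.RingOfIntegers ℚ)) (s : ℕ), s ≤ padicValNat p (W.tamagawaNumberAt v) →
        ∀ (n : ℕ) (d : Literature.NumberTheory.EllipticCurves.KolyvaginHeegnerData Dt β ι n), Squarefree n →
          (∀ ℓ ∈ n.primeFactors, Literature.NumberTheory.EllipticCurves.Zhang2014.IsKolyvaginPrime (W.conductorNorm ℤ) W K p ℓ ∧
            s ≤ Literature.NumberTheory.EllipticCurves.Zhang2014.kolyvaginIndex W p ℓ) →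
          Summit.BirchSwinnertonDyer.Rank1Residual.X11b.Three.Koly.PDiv d p s :=
  Summit.BirchSwinnertonDyer.Rank1Residual.X11b.AtP.Koly.jetchevMaxHLAtP_of_swapPrint hF.1 hGZ hmod
    (poitouTate_conj_forall_of_selmerComplement_canonical hF.2.1) hF.2.2

/-- **S1b — the exceptional-zero core of crux 19715 (registered text VERBATIM as conclusion) MODULO THREE PRINTED FACTS, the Cassels–Tate level inputs
and the X11a lower half.** McCallum Prop. 5.2 no longer appears (bsd-jet's kernel prime swap via -w2's p616221). PROOF: consumer p612480 fed with
`jetchevMaxHLAtP_of_swapPrintFacts`, McCallum Cor. 5.6 upper by tam3-p1 g9, the Literature THEOREMS `heegnerPointOfConductor_one_galoisConj_holds` ∕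
`phi_heegnerTau_mem_singularModuliField_holds`. CONDITIONAL (printed facts + open 19064); no pair booked.
[cite: Jetchev2008, Thm. 1.4, Cor. 1.5] [cite: McCallumLMS1991, Cor. 5.6] [cite: GrossLMS1991, §4 (4.1)] [cite: Miller2011LMS, Def. 1.1] -/
theorem res_pOnlyMultCarrierAtFive_of_swapPrintFacts_of_lowerX11a
    (hGZ : ∀ (N : ℕ) [NeZero N] (W : WeierstrassCurve ℚ) (K : Type) [Field K] [NumberField K], gross_zagier N W K)
    (hKo : ∀ (N : ℕ) [NeZero N] (W : WeierstrassCurve ℚ) (K : Type) [Field K] [NumberField K], kolyvagin N W K)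
    (hGZK : rank_eq_analyticRank_of_analyticRank_le_one) (hmod : hasEntireLFunction_rat)
    (hnf : exists_isNewformOf) (hHL : HoffsteinLuo1997_exists_twist_L_one_ne_zero)
    (hMaz : mazur_not_dvd_maninConstant_of_odd)
    (hCTi : ∀ (K : Type) [Field K] [NumberField K], casselsTate_levelInputs K)
    (hF : Literature.NumberTheory.EllipticCurves.GrossLMS1991.prop37_2_frobeniusCongruence ∧
      (∀ (K : Type) [Field K] [NumberField K] (n : ℕ) [NeZero n],
        (Literature.NumberTheory.GaloisCohomology.LocalInvariants.canonical K n).SelmerComplement) ∧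
      Literature.NumberTheory.EllipticCurves.Gross1991_heegnerPoint_sub_ratTorsion_mem_E0)
    (hX11a : ∀ (Wd : WeierstrassCurve ℚ) [Wd.IsElliptic] [Wd.IsGloballyMinimal] (p : ℕ) [Fact p.Prime],
      ClassX11a Wd p → Typed.MissingLowerBoundAt Wd p) :
    ∀ (W : WeierstrassCurve ℚ) [W.IsElliptic] [W.IsGloballyMinimal] (p : ℕ) [Fact p.Prime], Summit.BirchSwinnertonDyer.Rank1Residual.ClassX11b W p → 5 ≤ p → Literature.NumberTheory.EllipticCurves.Rank1Residual.Surj W p → ¬ Literature.NumberTheory.EllipticCurves.Rank1Residual.Ram W p → p ∣ W.tamagawaProduct → (∀ (ℓ : ℕ) [Fact ℓ.Prime], W.HasMultiplicativeReductionAtPrime ℓ → ℓ = p) → W.HasSplitMultiplicativeReductionAtPrime p → p ∣ padicValInt p W.minimalDiscriminantInt → Literature.NumberTheory.EllipticCurves.Rank1Residual.Typed.MissingUpperBoundAt W p :=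
  res_pOnlyMultCarrierAtFive_of_jetchevMaxHL_of_lowerX11a hGZ hKo hGZK hmod hnf hHL hMaz
    (fun N _ W K _ _ ↦ heegnerPointOfConductor_one_galoisConj_holds N W K)
    (fun N _ W K _ _ ↦ phi_heegnerTau_mem_singularModuliField_holds N W K)
    (McCallum1991_padicValNat_card_sha_primary_add_le_of_globalDivisibility_of_casselsTate_of_frobeniusCongruence_of_E0
      hCTi hF.1 hF.2.2)
    (jetchevMaxHLAtP_of_swapPrintFacts hF hGZ hmod) hX11a

end Summit.BirchSwinnertonDyer.BirchSwinnertonDyer.Theorems.JetchevMaxHLAtP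

end
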